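import Literature.Analysis.Complex.PQOperators
import Literature.Analysis.Complex.DbarAlongHolomorphic
import Literature.NumberTheory.Transcendental.DolbeaultProofs
import Mathlib.Analysis.Calculus.DifferentialForm.Basic
import HarnessLib

/-!
# The coordinate formula for `d` and `∂̄` on flat forms: `∂̄α = ∑_j dz̄_j ∧ ∂α/∂z̄_j`

On `ℂ^ι` (`E = ι → ℂ`) every real Fréchet derivative splits as
`Du(x)[w] = ∑_j (w_j ∂_j u (x) + w̄_j ∂̄_j u (x))` with `∂_j = ∂/∂z_j`, `∂̄_j = ∂/∂z̄_j`
(`fderiv_eq_sum_dz_smulRight`; `∂/∂z̄_j = dbarAlong (Pi.single j 1)`,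
`∂/∂z_j = delAlong (Pi.single j 1)`), hence Mathlib's exterior derivative of a form
`α : ℂ^ι → Λ^k` is

  `dα(x) = ∑_j (dz_j ∧ ∂_j α (x) + dz̄_j ∧ ∂̄_j α (x))`      (`extDeriv_eq_sum_wedgeOne`),

with `θ ∧ η = wedgeOne θ η` (`Literature/LinearAlgebra/Alternating/WedgeOne.lean`). For `α` with
values of type `(p,q)` the first terms have type `(p+1,q)` and the second `(p,q+1)`
(`Literature/Analysis/Complex/PQOperators.lean`), so the `(p,q+1)`-component of `dα` is

  `(dα)^{p,q+1}(x) = ∑_j dz̄_j ∧ ∂̄_j α (x) = ∂̄α(x)`      (`typeProjAt_extDeriv_eq_sum`),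

Hörmander's coordinate expression of `∂̄` (1973, §2.1, `∂̄f = ∑ ∂f_{I,J}/∂z̄_j dz̄_j ∧ dz^I ∧ dz̄^J`)
— and, through the bridges of `Literature/Analysis/Complex/PQTypes.lean` and the tree's
`IsOfType.dolbeaultBar_eq` (discharged) and `mextDeriv_eq_extDeriv`, the tree's Dolbeault
operator on the flat complex manifold `ℂ^ι` (`dolbeaultBar_apply_eq_sum`).

## References

* L. Hörmander, *An Introduction to Complex Analysis in Several Variables*, 2nd ed. (1973),
  §2.1 (the operators `∂`, `∂̄` in coordinates). [HormanderSCV1973]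
* C. Voisin, *Hodge Theory and Complex Algebraic Geometry I* (2002), §2.3.1, Def. 2.27.
  [Voisin2002]
-/

noncomputable section

open scoped Manifold ComplexConjugate
open Complex Function ContinuousAlternatingMap
open Literature.LinearAlgebra.Alternating Literature.Geometry.Kaehler Literature.NumberTheory.Transcendental

namespace Literature.Analysis.Complex

variable {E : Type*} [NormedAddCommGroup E] [NormedSpace ℂ E]
  {F : Type*} [NormedAddCommGroup F] [NormedSpace ℂ F]

/-! ### The `(1,0)`-directional derivative `∂_v` -/

/-- The **`(1,0)`-directional derivative** `∂_v u (x) = ½ (Du(x)[v] - i Du(x)[iv])`, companion of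
`dbarAlong v u x = ½ (Du(x)[v] + i Du(x)[iv])`; for `E = ℂⁿ`, `v = e_j` it is `∂u/∂z_j`
(Hörmander (1973), §1.1/§2.1). [cite: HormanderSCV1973, §2.1] -/
def delAlong (v : E) (u : E → F) (x : E) : F :=
  (2 : ℂ)⁻¹ • (fderiv ℝ u x v - I • fderiv ℝ u x (I • v))

/-- Unfolding of `delAlong`. [folklore] -/
theorem delAlong_apply (v : E) (u : E → F) (x : E) :
    delAlong v u x = (2 : ℂ)⁻¹ • (fderiv ℝ u x v - I • fderiv ℝ u x (I • v)) :=
  rfl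

/-- **Splitting of the real derivative into `(1,0)` and `(0,1)` parts**:
`Du(x)[c v] = c ∂_v u (x) + c̄ ∂̄_v u (x)` (Hörmander (1973), §1.1, `du = ∂u/∂z dz + ∂u/∂z̄ dz̄`).
[cite: HormanderSCV1973, §1.1] -/
theorem fderiv_apply_smul_eq (u : E → F) (x : E) (c : ℂ) (v : E) :
    fderiv ℝ u x (c • v) = c • delAlong v u x + conj c • dbarAlong v u x := by
  have hc : c • v = (c.re : ℝ) • v + (c.im : ℝ) • (I • v) := by
    rw [← Complex.coe_smul, ← Complex.coe_smul, smul_smul, ← add_smul, re_add_im]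
  rw [hc, map_add, map_smul, map_smul, delAlong_apply, dbarAlong_apply]
  have hconj : conj c = (c.re : ℂ) - (c.im : ℂ) * I := by
    apply Complex.ext <;> simp
  have hcc : c = (c.re : ℂ) + (c.im : ℂ) * I := (re_add_im c).symm
  conv_lhs => rw [← Complex.coe_smul, ← Complex.coe_smul]
  rw [hconj]
  match_scalars <;>
    first
    | linear_combination (-(2 : ℂ)⁻¹) * hcc
    | linear_combination ((2 : ℂ)⁻¹ * I) * hcc + (c.im : ℂ) * I_mul_I

/-! ### Coordinates: `Du = ∑_j (dz_j ∂_j u + dz̄_j ∂̄_j u)` -/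

section Coordinates

variable {ι : Type*} [Fintype ι] [DecidableEq ι]

/-- A vector of `ℂ^ι` in the coordinate basis: `w = ∑_j w_j • e_j`. [folklore] -/
theorem eq_sum_smul_single (w : ι → ℂ) : w = ∑ j, w j • (Pi.single j (1 : ℂ) : ι → ℂ) := by
  ext i
  simp [Finset.sum_apply, Pi.single_apply]

/-- **`Du(x) = ∑_j (dz_j ⊗ ∂_j u (x) + dz̄_j ⊗ ∂̄_j u (x))`** as real continuous linear maps on
`ℂ^ι` (Hörmander (1973), §2.1, (2.1.1): `du = ∑ ∂u/∂z_j dz_j + ∑ ∂u/∂z̄_j dz̄_j`).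
[cite: HormanderSCV1973, §2.1] -/
theorem fderiv_eq_sum_dz_smulRight (u : (ι → ℂ) → F) (x : ι → ℂ) :
    fderiv ℝ u x = ∑ j, ((dz j).smulRight (delAlong (Pi.single j 1) u x) +
      (dzBar j).smulRight (dbarAlong (Pi.single j 1) u x)) := by
  ext w
  conv_lhs => rw [eq_sum_smul_single w]
  simp only [_root_.map_sum, _root_.sum_apply, _root_.add_apply,
    ContinuousLinearMap.smulRight_apply, dz_apply, dzBar_apply, fderiv_apply_smul_eq]

/-- **The coordinate formula for the exterior derivative**:
`dα(x) = ∑_j (dz_j ∧ ∂_j α (x) + dz̄_j ∧ ∂̄_j α (x))` for every form `α : ℂ^ι → Λ^k` (Mathlib's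
`extDeriv`; Hörmander (1973), §2.1, `d = ∂ + ∂̄` in coordinates). [cite: HormanderSCV1973, §2.1] -/
theorem extDeriv_eq_sum_wedgeOne {k : ℕ} (α : (ι → ℂ) → (ι → ℂ) [⋀^Fin k]→L[ℝ] F) (x : ι → ℂ) :
    extDeriv α x = ∑ j, (wedgeOne (dz j) (delAlong (Pi.single j 1) α x) +
      wedgeOne (dzBar j) (dbarAlong (Pi.single j 1) α x)) := by
  rw [extDeriv, fderiv_eq_sum_dz_smulRight]
  simp only [wedgeOne, ← alternatizeUncurryFinCLM_apply, _root_.map_sum, map_add]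

end Coordinates

/-! ### Types of the directional derivatives -/

section Types

variable {k : ℕ}

/-- `∂̄_v α (x)` has type `(p,q)` if all values of `α` do. [cite: HormanderSCV1973, §2.1] -/
theorem IsOfTypeAt.dbarAlong {p q : ℕ} {α : E → E [⋀^Fin k]→L[ℝ] ℂ} (hα : ∀ y, IsOfTypeAt p q (α y))
    {x : E} (hd : DifferentiableAt ℝ α x) (v : E) :
    IsOfTypeAt p q (Literature.Analysis.Complex.dbarAlong v α x) := by
  rw [dbarAlong_apply]
  exact ((IsOfTypeAt.fderiv_apply hα hd v).add ((IsOfTypeAt.fderiv_apply hα hd (I • v)).smul I)).smul _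

/-- `∂_v α (x)` has type `(p,q)` if all values of `α` do. [cite: HormanderSCV1973, §2.1] -/
theorem IsOfTypeAt.delAlong {p q : ℕ} {α : E → E [⋀^Fin k]→L[ℝ] ℂ} (hα : ∀ y, IsOfTypeAt p q (α y))
    {x : E} (hd : DifferentiableAt ℝ α x) (v : E) :
    IsOfTypeAt p q (Literature.Analysis.Complex.delAlong v α x) := by
  rw [delAlong_apply]
  exact ((IsOfTypeAt.fderiv_apply hα hd v).sub ((IsOfTypeAt.fderiv_apply hα hd (I • v)).smul I)).smul _

/-- If `α` is not differentiable at `x`, `∂̄_v α (x) = 0` (junk value of `fderiv`). [folklore] -/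
theorem dbarAlong_eq_zero_of_not_differentiableAt {α : E → F} {x : E} (h : ¬DifferentiableAt ℝ α x)
    (v : E) : Literature.Analysis.Complex.dbarAlong v α x = 0 := by
  simp [dbarAlong_apply, fderiv_zero_of_not_differentiableAt h]

/-- If `α` is not differentiable at `x`, `∂_v α (x) = 0`. [folklore] -/
theorem delAlong_eq_zero_of_not_differentiableAt {α : E → F} {x : E} (h : ¬DifferentiableAt ℝ α x)
    (v : E) : Literature.Analysis.Complex.delAlong v α x = 0 := by
  simp [delAlong_apply, fderiv_zero_of_not_differentiableAt h]

end Types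

/-! ### `∂̄α = ∑_j dz̄_j ∧ ∂̄_j α` -/

section Dbar

variable {ι : Type*} [Fintype ι] [DecidableEq ι] {k : ℕ}

omit [DecidableEq ι] in
/-- The type projection of a finite sum. [folklore] -/
theorem typeProjAt_sum (p q : ℕ) {β : Type*} (s : Finset β)
    (η : β → (ι → ℂ) [⋀^Fin k]→L[ℝ] ℂ) :
    typeProjAt p q (∑ b ∈ s, η b) = ∑ b ∈ s, typeProjAt p q (η b) :=
  _root_.map_sum (typeProjₗ (E := ι → ℂ) (k := k) p q) η s

/-- **Hörmander's coordinate formula for `∂̄`** on flat forms of type `(p,q)`: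
`(dα)^{p,q+1}(x) = ∑_j dz̄_j ∧ ∂̄_j α (x)` for `α : ℂ^ι → Λ^{p+q}` with values of type `(p,q)`
(Hörmander (1973), §2.1: `∂̄f = ∑_{I,J} ∑_j ∂f_{I,J}/∂z̄_j dz̄_j ∧ dz^I ∧ dz̄^J`; the terms
`dz_j ∧ ∂_j α` of `dα` have type `(p+1,q)` and drop out). [cite: HormanderSCV1973, §2.1] -/
theorem typeProjAt_extDeriv_eq_sum {p q : ℕ} {α : (ι → ℂ) → (ι → ℂ) [⋀^Fin k]→L[ℝ] ℂ}
    (hα : ∀ y, IsOfTypeAt p q (α y)) (x : ι → ℂ) :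
    typeProjAt p (q + 1) (extDeriv α x) =
      ∑ j, wedgeOne (dzBar j) (dbarAlong (Pi.single j 1) α x) := by
  have hk : p + q = k := (hα x).1
  by_cases hd : DifferentiableAt ℝ α x
  · rw [extDeriv_eq_sum_wedgeOne, typeProjAt_sum]
    refine Finset.sum_congr rfl fun j _ => ?_
    rw [typeProjAt_add]
    have h1 : IsOfTypeAt (p + 1) q (wedgeOne (dz j) (delAlong (Pi.single j 1) α x)) :=
      (IsOfTypeAt.delAlong hα hd _).wedgeOne_of_linear fun c w => by
        rw [dz_apply, dz_apply, Pi.smul_apply, smul_eq_mul]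
    have h2 : IsOfTypeAt p (q + 1) (wedgeOne (dzBar j) (dbarAlong (Pi.single j 1) α x)) :=
      (IsOfTypeAt.dbarAlong hα hd _).wedgeOne_of_conj fun c w => by
        rw [dzBar_apply, dzBar_apply, Pi.smul_apply, smul_eq_mul, map_mul]
    rw [h1.typeProjAt_of_ne (Or.inl (Nat.succ_ne_self p)), h2.typeProjAt_eq_self, zero_add]
  · have h0 : extDeriv α x = 0 := by
      rw [extDeriv, fderiv_zero_of_not_differentiableAt hd, ← alternatizeUncurryFinCLM_apply, _root_.map_zero]
    rw [h0, typeProjAt_zero]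
    symm
    refine Finset.sum_eq_zero fun j _ => ?_
    rw [dbarAlong_eq_zero_of_not_differentiableAt hd, wedgeOne_zero]

/-- **The tree's Dolbeault operator on the flat complex manifold `ℂ^ι` in coordinates**: for a
form `α : ℂ^ι → Λ^{p+q}` of type `(p,q)`,
`∂̄α (x) = ∑_j dz̄_j ∧ ∂̄_j α (x)` (`Literature.NumberTheory.Transcendental.dolbeaultBar` via the
discharged fact `IsOfType.dolbeaultBar_eq`, `mextDeriv_eq_extDeriv` and `typeComponent_apply`).
[cite: HormanderSCV1973, §2.1] -/
theorem dolbeaultBar_apply_eq_sum {p q : ℕ} {α : (ι → ℂ) → (ι → ℂ) [⋀^Fin k]→L[ℝ] ℂ}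
    (hα : ∀ y, IsOfTypeAt p q (α y)) (x : ι → ℂ) :
    dolbeaultBar (show MForm 𝓘(ℝ, ι → ℂ) (ι → ℂ) ℂ k from α) x =
      ∑ j, wedgeOne (dzBar j) (dbarAlong (Pi.single j 1) α x) := by
  have hty : IsOfType p q (show MForm 𝓘(ℝ, ι → ℂ) (ι → ℂ) ℂ k from α) :=
    (isOfType_iff_forall_isOfTypeAt p q α).2 hα
  rw [IsOfType.dolbeaultBar_eq_holds hty]
  have hd : mextDeriv (show MForm 𝓘(ℝ, ι → ℂ) (ι → ℂ) ℂ k from α) =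
      show MForm 𝓘(ℝ, ι → ℂ) (ι → ℂ) ℂ (k + 1) from extDeriv α := by
    funext y
    exact mextDeriv_eq_extDeriv _ y
  rw [hd, typeComponent_apply, typeProjAt_extDeriv_eq_sum hα]

end Dbar

end Literature.Analysis.Complex
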